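import Summits.CriticalPhenomena.PercolationContinuityZ3.Theorems.PercNearOneGluingNoHeavyLowerTailKNGoodTwinStars
import Summits.CriticalPhenomena.PercolationContinuityZ3.Theorems.PercNearOneGluingNoHeavyLowerTailKNGoodSharedStars
import HarnessLib

/-!
# Kozma–Nitzan goodness for an observer with two pendant star children having AT MOST TWO ports each, over an arbitrary core
# (`NoHeavyLowerTail` cell, stmt-CriticalPhenomena-4575; prover `prim-hp-2`, deletion–contraction line, gen 8)

Support file (`--supports stmt-CriticalPhenomena-4575`).  No definitions, no named facts, no sorries.

THEOREM `KNGoodTwoTwo.knGood_twoPendantStars_portsLeTwo` — the umbrella of the cell's depth-two kernel at goodness strength: `o ∉ A` with relay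
hairs (free) and two Steiner children `x, y ∉ A`, each a pendant relay-star whose port set (`Px`, `Py ⊆ A`) has at most two elements, hairs to the
ports in `(0,1)`, every other pair at `x, y` of weight `0`; the core — everything else — ARBITRARY.  Then `(G, A, o, b)` is good (Kozma–Nitzan §3.2).
Case analysis: a child with ≤ 1 port — `KNGoodSinglePort.knGood_twoStars_singlePort`; two ports each — disjoint `knGood_twoPendantTwoPortStars`,
one shared port `knGood_twoPendantTwoPortStars_shared`, same ports `knGood_twinTwoPortStars`.
-/

namespace Summit.CriticalPhenomena.PercolationContinuityZ3.Theorems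

open MeasureTheory Set ProbabilityTheory Literature.Probability.LatticeModels Literature.Probability.Percolation

noncomputable section
open Classical
namespace KNGoodTwoTwo
open KNGoodSinglePort

variable {n : ℕ}

/-- **Goodness for `o` + relay hairs + two pendant stars with at most two ports each, over an arbitrary core.**  See the module docstring.
[cite: KozmaNitzan2024, §3.2 Definition (p. 12), Thm. 4–5 and Lemma 5 (pp. 12–14), Lemma 4 (p. 7), Lemma 3(i) (p. 6); VandenbergHaggstromKahn2005, Thm. 1.2] -/
theorem knGood_twoPendantStars_portsLeTwo (w : Sym2 (Fin n) → unitInterval) (A : Finset (Fin n)) (hA : A.Nonempty)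
    (o x y b : Fin n) (Px Py : Finset (Fin n)) (ho : o ∉ A) (hx : x ∉ A) (hy : y ∉ A) (hxo : x ≠ o) (hyo : y ≠ o) (hxy : x ≠ y)
    (hbo : b ≠ o) (hbx : b ≠ x) (hby : b ≠ y) (hPx : Px ⊆ A) (hPy : Py ⊆ A) (hcx : Px.card ≤ 2) (hcy : Py.card ≤ 2)
    (hoN : ∀ v : Fin n, v ≠ o → v ∉ A → v ≠ x → v ≠ y → w s(o, v) = 0)
    (hxN : ∀ z : Fin n, z ∉ Px → z ≠ o → w s(x, z) = 0) (hyN : ∀ z : Fin n, z ∉ Py → z ≠ o → w s(y, z) = 0)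
    (hxh : ∀ p ∈ Px, 0 < (w s(x, p) : ℝ) ∧ (w s(x, p) : ℝ) < 1) (hyh : ∀ q ∈ Py, 0 < (w s(y, q) : ℝ) ∧ (w s(y, q) : ℝ) < 1) :
    KNGood w A hA o b := by
  have hoN' : ∀ v : Fin n, v ≠ o → v ∉ A → v ≠ y → v ≠ x → w s(o, v) = 0 := fun v h1 h2 h3 h4 => hoN v h1 h2 h4 h3
  have hxNA : ∀ z : Fin n, z ≠ x → z ∉ A → z ≠ o → w s(x, z) = 0 := fun z _ hzA hzo => hxN z (fun h => hzA (hPx h)) hzo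
  have hyNA : ∀ z : Fin n, z ≠ y → z ∉ A → z ≠ o → w s(y, z) = 0 := fun z _ hzA hzo => hyN z (fun h => hzA (hPy h)) hzo
  -- a child with at most one port
  by_cases hx1 : Px.card ≤ 1
  · obtain ⟨p, hpA, hpx⟩ : ∃ p ∈ A, ∀ z : Fin n, z ≠ x → z ≠ p → z ≠ o → w s(x, z) = 0 := by
      rcases Nat.le_one_iff_eq_zero_or_eq_one.1 hx1 with h0 | h1
      · obtain ⟨p, hp⟩ := hA
        exact ⟨p, hp, fun z _ _ hzo => hxN z (by rw [Finset.card_eq_zero.1 h0]; simp) hzo⟩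
      · obtain ⟨p, hPp⟩ := Finset.card_eq_one.1 h1
        exact ⟨p, hPx (by rw [hPp]; simp), fun z _ hzp hzo => hxN z (by rw [hPp]; simpa using hzp) hzo⟩
    exact knGood_twoStars_singlePort w A hA o x y p b ho hx hy hxo hyo hxy hbo hbx hby hpA hoN hpx hyNA
  by_cases hy1 : Py.card ≤ 1
  · obtain ⟨q, hqA, hqy⟩ : ∃ q ∈ A, ∀ z : Fin n, z ≠ y → z ≠ q → z ≠ o → w s(y, z) = 0 := by
      rcases Nat.le_one_iff_eq_zero_or_eq_one.1 hy1 with h0 | h1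
      · obtain ⟨q, hq⟩ := hA
        exact ⟨q, hq, fun z _ _ hzo => hyN z (by rw [Finset.card_eq_zero.1 h0]; simp) hzo⟩
      · obtain ⟨q, hPq⟩ := Finset.card_eq_one.1 h1
        exact ⟨q, hPy (by rw [hPq]; simp), fun z _ hzq hzo => hyN z (by rw [hPq]; simpa using hzq) hzo⟩
    exact knGood_twoStars_singlePort w A hA o y x q b ho hy hx hyo hxo hxy.symm hbo hby hbx hqA hoN' hqy hxNA
  -- both children have exactly two ports
  obtain ⟨p₁, p₂, hp, hPxe⟩ := Finset.card_eq_two.1 (le_antisymm hcx (by omega))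
  obtain ⟨q₁, q₂, hq, hPye⟩ := Finset.card_eq_two.1 (le_antisymm hcy (by omega))
  subst hPxe; subst hPye
  have hp₁A : p₁ ∈ A := hPx (by simp)
  have hp₂A : p₂ ∈ A := hPx (by simp)
  have hq₁A : q₁ ∈ A := hPy (by simp)
  have hq₂A : q₂ ∈ A := hPy (by simp)
  have hxN2 : ∀ z : Fin n, z ≠ p₁ → z ≠ p₂ → z ≠ o → w s(x, z) = 0 := fun z h1 h2 hzo => hxN z (by simp [h1, h2]) hzo
  have hxN2' : ∀ z : Fin n, z ≠ p₂ → z ≠ p₁ → z ≠ o → w s(x, z) = 0 := fun z h1 h2 hzo => hxN2 z h2 h1 hzo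
  have hyN2 : ∀ z : Fin n, z ≠ q₁ → z ≠ q₂ → z ≠ o → w s(y, z) = 0 := fun z h1 h2 hzo => hyN z (by simp [h1, h2]) hzo
  have hyN2' : ∀ z : Fin n, z ≠ q₂ → z ≠ q₁ → z ≠ o → w s(y, z) = 0 := fun z h1 h2 hzo => hyN2 z h2 h1 hzo
  have hh₁ := hxh p₁ (by simp); have hh₂ := hxh p₂ (by simp)
  have hk₁ := hyh q₁ (by simp); have hk₂ := hyh q₂ (by simp)
  by_cases e11 : p₁ = q₁
  · subst e11
    by_cases e22 : p₂ = q₂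
    · subst e22
      exact knGood_twinTwoPortStars w A hA o x y b p₁ p₂ ho hx hy hxo hyo hxy hbo hbx hby hp₁A hp₂A hp hoN hxN2 hyN2
        hk₁.1 hk₁.2 hk₂.1 hk₂.2
    · exact knGood_twoPendantTwoPortStars_shared w A hA o x y b p₁ p₂ q₂ ho hx hy hxo hyo hxy hbo hbx hby hp₁A hp₂A hq₂A hp hq e22
        hoN hxN2 hyN2 hk₁.1 hk₁.2 hk₂.1 hk₂.2
  by_cases e12 : p₁ = q₂
  · subst e12
    by_cases e21 : p₂ = q₁
    · subst e21
      exact knGood_twinTwoPortStars w A hA o x y b p₁ p₂ ho hx hy hxo hyo hxy hbo hbx hby hp₁A hp₂A hp hoN hxN2 hyN2'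
        hk₂.1 hk₂.2 hk₁.1 hk₁.2
    · exact knGood_twoPendantTwoPortStars_shared w A hA o x y b p₁ p₂ q₁ ho hx hy hxo hyo hxy hbo hbx hby hp₁A hp₂A hq₁A hp hq.symm e21
        hoN hxN2 hyN2' hk₂.1 hk₂.2 hk₁.1 hk₁.2
  by_cases e21 : p₂ = q₁
  · subst e21
    have e22 : p₁ ≠ q₂ := e12
    exact knGood_twoPendantTwoPortStars_shared w A hA o x y b p₂ p₁ q₂ ho hx hy hxo hyo hxy hbo hbx hby hp₂A hp₁A hq₂A hp.symm hq e22
      hoN hxN2' hyN2 hk₁.1 hk₁.2 hk₂.1 hk₂.2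
  by_cases e22 : p₂ = q₂
  · subst e22
    exact knGood_twoPendantTwoPortStars_shared w A hA o x y b p₂ p₁ q₁ ho hx hy hxo hyo hxy hbo hbx hby hp₂A hp₁A hq₁A hp.symm hq.symm e11
      hoN hxN2' hyN2' hk₂.1 hk₂.2 hk₁.1 hk₁.2
  exact knGood_twoPendantTwoPortStars w A hA o x y b p₁ p₂ q₁ q₂ ho hx hy hxo hyo hxy hbo hbx hby hp₁A hp₂A hq₁A hq₂A hp hq e11 e12 e21 e22
    hoN hxN2 hyN2 hh₁.1 hh₁.2 hh₂.1 hh₂.2 hk₁.1 hk₁.2 hk₂.1 hk₂.2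

end KNGoodTwoTwo

end

end Summit.CriticalPhenomena.PercolationContinuityZ3.Theorems
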